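import Mathlib
import Summits.Ventures.HodgeRepro.CMType
import Summits.Ventures.HodgeRepro.HodgeSets
import Summits.Ventures.HodgeRepro.CMRank
import Summits.Ventures.HodgeRepro.Groups
import Summits.Ventures.HodgeRepro.Primitive
import Summits.Ventures.HodgeRepro.MuTable
import Summits.Ventures.HodgeRepro.MuDecide
import Summits.Ventures.HodgeRepro.MuWeightsTransport
import Summits.Ventures.HodgeRepro.MuPairs
import Summits.Ventures.HodgeRepro.MuPairsRank

/-!
# The pairs theorem across the census (blind cell `pub-hodge-repro`, seat p2)

p1's kernel-checked rank census (`RankCensus*.lean`) writes every CM type of every `(G, c)` of order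
`6/8/12` as a left translate `g • reps k` of an orbit representative with known rank `ranks k`.  The
weight census `(weightsN Φ).card` is translation invariant (`MuWeightsTransport.lean`) and decidable on
the representatives.  Hence the pairs theorem (`MuPairsRank.lean`) applies to every CM type whose
representative has `(weightsN (reps k)).card = 2 (ranks k − 1)`: all CM types of degree `6` and `8`,
all of `C12`, `D6`, `Dic3`, and all of `C6 × C2` except the primitive rank-`6` orbits.  For these, every
Pohlmann set is a disjoint union of antipodal pairs — every Hodge class is a product of `(1,1)`-classes.
-/

set_option autoImplicit false

open Finset
open scoped Pointwise

namespace HodgeRepro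

variable {G : Type*} [Group G] [DecidableEq G] [Fintype G]

/-- Generic wrapper: the pairs theorem on the translation orbit of a representative. -/
theorem isPairUnion_of_rep {c : G} (hc : IsComplexConj c) {R : Finset G} (hR : IsCMType c R) {r : ℕ}
    (hrank : cmRank R = r) (hw : (weightsN R).card = 2 * (r - 1)) (hr : 1 ≤ r) (g : G)
    {Δ : Finset G} (hΔ : IsHodgeSet c (g • R) Δ) : IsPairUnion (g • R) Δ := by
  refine isPairUnion_of_isHodgeSet' hc (hR.smul hc g) (k := r - 1) ?_ ?_ hΔ
  · rw [card_weightsN_smul, hw]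
  · rw [cmRank_smul, hrank]
    omega

/-- The pairs theorem for every CM type covered by a representative list (with the weight-census check
per representative). -/
theorem isPairUnion_of_cover {c : G} (hc : IsComplexConj c) {m : ℕ} (reps : Fin m → Finset G)
    (ranks : Fin m → ℕ) (hreps : ∀ k, IsCMType c (reps k)) (hrank : ∀ k, cmRank (reps k) = ranks k)
    (hw : ∀ k, (weightsN (reps k)).card = 2 * (ranks k - 1)) (hr : ∀ k, 1 ≤ ranks k)
    (cover : ∀ Φ : Finset G, IsCMType c Φ → ∃ g : G, ∃ k : Fin m, Φ = g • reps k)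
    {Φ : Finset G} (hΦ : IsCMType c Φ) {Δ : Finset G} (hΔ : IsHodgeSet c Φ Δ) : IsPairUnion Φ Δ := by
  obtain ⟨g, k, rfl⟩ := cover Φ hΦ
  exact isPairUnion_of_rep hc (hreps k) (hrank k) (hw k) (hr k) g hΔ

/-- Variant of the cover wrapper excluding the representatives of one rank (the `C6 × C2` rank-`6` orbits). -/
theorem isPairUnion_of_cover_ne {c : G} (hc : IsComplexConj c) {m : ℕ} (reps : Fin m → Finset G)
    (ranks : Fin m → ℕ) (bad : ℕ) (hreps : ∀ k, IsCMType c (reps k))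
    (hrank : ∀ k, cmRank (reps k) = ranks k)
    (hw : ∀ k, ranks k ≠ bad → (weightsN (reps k)).card = 2 * (ranks k - 1)) (hr : ∀ k, 1 ≤ ranks k)
    (cover : ∀ Φ : Finset G, IsCMType c Φ → ∃ g : G, ∃ k : Fin m, Φ = g • reps k)
    {Φ : Finset G} (hΦ : IsCMType c Φ) (hne : cmRank Φ ≠ bad) {Δ : Finset G}
    (hΔ : IsHodgeSet c Φ Δ) : IsPairUnion Φ Δ := by
  obtain ⟨g, k, rfl⟩ := cover Φ hΦ
  have hk : ranks k ≠ bad := by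
    rw [cmRank_smul, hrank k] at hne
    exact hne
  exact isPairUnion_of_rep hc (hreps k) (hrank k) (hw k hk) (hr k) g hΔ

end HodgeRepro
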